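import Literature.Probability.LatticeModels.FKIsingCylinderIdentityAssembly
import Literature.Probability.LatticeModels.InterfaceSLESource
import Literature.Probability.LatticeModels.MedialInterfaceProofs
import HarnessLib

/-!
# FK-Ising interfaces: subsequential limits are carried by curves from `a`

Topic `Literature/Probability/LatticeModels` (family `crit-ising`); theorems only. FK-Ising
counterpart of `InterfaceSLESource.lean` (spin side), serving the cylinder-identity data (M5′)
of CDHKS §3 — Chelkak–Duminil-Copin–Hongler–Kemppainen–Smirnov, C. R. Math. 352 (2014), Thm. 2,
Thm. 3 and §3: a version of the driving process of a subsequential limit whose time-limited FK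
observable satisfies the martingale identity against cylinder test functions (the hypotheses of
`isSLELaw_sixteen_thirds_of_cylinderIdentity`; formerly also the closed named fact
`exists_cylinderObservableIdentity_fkInterface` of `FKIsingNaturalMartingale.lean`, merged back
into the proof obligation by the D-0026 review of 2026-08-15). The tree's assembly
`exists_cylinderIdentityData_of_limitData` (`FKIsingCylinderIdentityAssembly.lean`) derives these
data from the Kemppainen–Smirnov data (J) and the discrete observable martingale data (D); among
the clauses of (J) is "`μ`-a.e. curve class starts at `a = D.pt 0`" (it makes the Loewner
transform `drivingFunction φ` vanish at time `0`). This clause is not an input of the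
printed proof but a property of every weak subsequential limit of interface laws of admissible
discretisations `(Ω_δ; a_δ, b_δ) → (Ω; a, b)` (CDHKS §1: the interfaces run "from `a_δ` to
`b_δ`" and `a_δ → a`). It is PROVED here from the lattice side:

* `IsMedialExploration.exists_cons_map_medialPoint` — the polygon of the FK interface (the
  medial exploration path of `MedialInterface.lean`) runs from the midpoint of one `A`–`B`
  boundary edge to the midpoint of the other (`IsMedialExploration.head_mem/getLast_mem/
  head_ne_getLast`, `IsZdAdmissible.ncard_zdABEdges_eq_two`), so the set of discrete marked
  points `medialPoint δ '' zdABEdges` is exactly the set of its two end points;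
* `dist_source_fkInterfaceCurve_lt` — if that set is within Hausdorff distance `ε ≤ |a - b|/2`
  of `{a, b}`, the re-oriented interface curve `fkInterfaceCurve D E ω` (`orientChord`) starts
  within `ε` of `a` (`dist_source_mk_polyline_orientChord_lt` of `InterfaceSLESource.lean`; the
  interface is the genuine exploration path by `isFKInterface_fkInterface_holds`);
* `ae_source_eq_of_tendsto_fkInterfaceCurve`, `ae_source_eq_of_isSubseqLimitLaw_fkInterfaceCurve`
  — the limit statement, through the bounded continuous test function
  `c ↦ min 1 (dist c.source a)`: its integral under the interface law at mesh `u n` is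
  eventually `≤ ε` (`IsDiscretisation.tendsto_zdABEdges`, `eventually_isZdAdmissible`), hence `0`
  in the limit;
* `exists_cylinderIdentityData_of_limitData'`,
  `exists_observableMartingale_fkInterface_of_limitData'` — the assembly of
  `FKIsingCylinderIdentityAssembly.lean` (the cylinder-identity data for one limit law; the
  layer-4 named fact (L‴) `exists_observableMartingale_fkInterface` globally) with the clause
  "curves from `a`" removed from its hypotheses: for a subsequential limit law of the FK
  interface laws it is automatic.

No definition and no named fact is introduced.

## References

* D. Chelkak, H. Duminil-Copin, C. Hongler, A. Kemppainen, S. Smirnov, *Convergence of Ising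
  interfaces to Schramm's SLE curves*, C. R. Math. Acad. Sci. Paris 352 (2014) 157–161
  (arXiv:1312.0533), §1 (discrete domains `(Ω_δ; a_δ, b_δ)` approximating `(Ω; a, b)`,
  interfaces from `a_δ` to `b_δ`), Thm. 2, Thm. 3 and §3.
* S. Smirnov, *Conformal invariance in random cluster models. I*, Ann. of Math. 172 (2010),
  §2.2 (the FK interface runs between the two boundary points).
* A. Kemppainen, S. Smirnov, *Random curves, scaling limits and Loewner evolutions*, Ann.
  Probab. 45 (2017), §1.2 (the normalisation of the driving process at time `0`).
-/

noncomputable section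

open MeasureTheory ProbabilityTheory Filter Topology Set Metric
open UpperHalfPlane (upperHalfPlaneSet)
open scoped ENNReal NNReal BoundedContinuousFunction
open Literature.Probability.RandomPlanarGeometry Literature.Probability.LatticeModels
  Literature.Probability.Percolation Literature.Probability.Process

namespace Literature.Probability.LatticeModels

open RandomPlanarGeometry.Loewner
open scoped Literature.Probability.RandomPlanarGeometry.PathBorel

/-! ### End points of the FK interface polygon -/

/-- **The polygon of the FK interface runs between the two discrete marked points.** For
admissible data `E` and a medial exploration path `γ` (`IsMedialExploration E ω γ`), the list of
polygon vertices `γ.map (medialPoint δ)` is nonempty and its first and last points are the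
midpoints of the two (distinct) `A`–`B` boundary edges, so that
`medialPoint δ '' E.zdABEdges = {first point, last point}`. (Smirnov 2010, §2.2: the interface
runs from `a` to `b`; CDHKS 2014, §1.) [cite: Smirnov2010, §2.2] [cite: CDHKSCRAS2014, §1] -/
theorem IsMedialExploration.exists_cons_map_medialPoint {E : DiscreteDobrushin}
    (hE : E.IsZdAdmissible) {ω : BondConfig (Site 2)} {γ : List MedialVertex}
    (hγ : IsMedialExploration E ω γ) (δ : ℝ) :
    ∃ (z : ℂ) (l : List ℂ), γ.map (medialPoint δ) = z :: l ∧
      medialPoint δ '' E.zdABEdges = {z, (z :: l).getLast (List.cons_ne_nil z l)} := by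
  have hne := hγ.ne_nil
  obtain ⟨e, rest, he⟩ := List.exists_cons_of_ne_nil hne
  have hhead : γ.head hne = e := by simp [he]
  have h0 : e ∈ E.zdABEdges := hhead ▸ hγ.head_mem
  have h1 : γ.getLast hne ∈ E.zdABEdges := hγ.getLast_mem
  have h01 : e ≠ γ.getLast hne := hhead ▸ hγ.head_ne_getLast
  -- `zdABEdges = {e, γ.getLast}`
  have hset : E.zdABEdges = {e, γ.getLast hne} := by
    obtain ⟨x, y, hxy, hxy'⟩ := Set.ncard_eq_two.1 hE.ncard_zdABEdges_eq_two
    rw [hxy'] at h0 h1 ⊢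
    rcases h0 with rfl | rfl <;> rcases h1 with h1 | h1
    · exact absurd h1.symm h01
    · rw [Set.mem_singleton_iff] at h1; rw [h1]
    · rw [h1, Set.pair_comm]
    · rw [Set.mem_singleton_iff] at h1; exact absurd h1.symm h01
  refine ⟨medialPoint δ e, rest.map (medialPoint δ), by rw [he, List.map_cons], ?_⟩
  rw [hset, Set.image_pair]
  congr 1
  have hlast : γ.getLast hne = (e :: rest).getLast (List.cons_ne_nil e rest) := by simp [he]
  rw [hlast]
  have h2 : (medialPoint δ e :: rest.map (medialPoint δ)) = (e :: rest).map (medialPoint δ) := rfl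
  simp only [h2, List.getLast_map]

/-! ### Orientation: the re-oriented FK interface starts near `a` -/

/-- **The FK interface curve starts within `ε` of `a`** when the data are admissible and the
discrete marked points are within Hausdorff distance `ε` (`2ε ≤ |a - b|`) of `{a, b}`: the
interface `fkInterface E ω` is the medial exploration path (`isFKInterface_fkInterface_holds`),
by `IsMedialExploration.exists_cons_map_medialPoint` the set of discrete marked points is the set
of end points of its polygon, and `dist_source_mk_polyline_orientChord_lt` applies to the
re-orientation `orientChord D` used by `fkInterfaceCurve`. [cite: CDHKSCRAS2014, §1] -/
theorem dist_source_fkInterfaceCurve_lt (D : DobrushinDomain) {E : DiscreteDobrushin}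
    (hE : E.IsZdAdmissible) (ω : BondConfig (Site 2)) {ε : ℝ} (hε0 : 0 < ε)
    (hε : 2 * ε ≤ dist (D.pt 0) (D.pt 1))
    (hH : hausdorffEDist (medialPoint E.δ '' E.zdABEdges) {D.pt 0, D.pt 1} < ENNReal.ofReal ε) :
    dist (fkInterfaceCurve D E ω).source (D.pt 0) < ε := by
  have hγ : IsMedialExploration E ω (fkInterface E ω) := isFKInterface_fkInterface_holds E hE ω
  obtain ⟨z, l, hzl, hset⟩ := hγ.exists_cons_map_medialPoint hE E.δ
  unfold fkInterfaceCurve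
  rw [hzl]
  -- translate the Hausdorff bound
  have hnear : ∀ p ∈ ({z, (z :: l).getLast (List.cons_ne_nil z l)} : Set ℂ),
      dist p (D.pt 0) < ε ∨ dist p (D.pt 1) < ε := by
    intro p hp
    rw [← hset] at hp
    obtain ⟨q, hq, hpq⟩ := exists_edist_lt_of_hausdorffEDist_lt hp hH
    rw [edist_dist, ENNReal.ofReal_lt_ofReal_iff hε0] at hpq
    rcases hq with rfl | rfl
    · exact Or.inl hpq
    · exact Or.inr hpq
  have ha : dist z (D.pt 0) < ε ∨ dist ((z :: l).getLast (List.cons_ne_nil z l)) (D.pt 0) < ε := by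
    have hH' : hausdorffEDist {D.pt 0, D.pt 1} (medialPoint E.δ '' E.zdABEdges) <
        ENNReal.ofReal ε := by
      rwa [hausdorffEDist_comm]
    obtain ⟨p, hp, hpq⟩ := exists_edist_lt_of_hausdorffEDist_lt (Set.mem_insert _ _) hH'
    rw [edist_dist, ENNReal.ofReal_lt_ofReal_iff hε0, dist_comm] at hpq
    rw [hset] at hp
    rcases hp with rfl | rfl
    · exact Or.inl hpq
    · exact Or.inr hpq
  exact dist_source_mk_polyline_orientChord_lt D hε (hnear z (Set.mem_insert _ _)) ha

/-! ### The limit statement -/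

/-- **Weak limits of the FK interface laws along meshes `u n → 0⁺` are carried by curves from
`a`.** Let `E` be admissible discretisations of the Dobrushin domain `(D; a, b)`
(`IsDiscretisation`), `u n → 0⁺` meshes and `μ` a finite measure on the curve space such that
`∫ f (fkInterfaceCurve D (E (u n)) ω) dφ_{E (u n)} → ∫ f dμ` for every bounded continuous `f`
(`φ_E = fkDobrushinMeasure E`, the critical FK-Ising Dobrushin measure). Then `μ`-a.e. curve
class starts at `a = D.pt 0`. Proof: the bounded continuous function
`g c = min 1 (dist c.source a) ≥ 0` has `∫ g (fkInterfaceCurve …) dφ ≤ ε` for all large `n`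
(every interface curve of an admissible discretisation at a mesh where the discrete marked
points are `ε`-close to `{a, b}` starts within `ε` of `a`, `dist_source_fkInterfaceCurve_lt`),
so `∫ g dμ = 0`. [cite: CDHKSCRAS2014, §1] -/
theorem ae_source_eq_of_tendsto_fkInterfaceCurve {D : DobrushinDomain} {E : ℝ → DiscreteDobrushin}
    (hE : IsDiscretisation D E) {u : ℕ → ℝ} (hu : Tendsto u atTop (𝓝[>] 0))
    {μ : Measure (CurveClass ℂ)} [IsFiniteMeasure μ]
    (hlim : ∀ f : CurveClass ℂ →ᵇ ℝ,
      Tendsto (fun n ↦ ∫ ω, f (fkInterfaceCurve D (E (u n)) ω) ∂fkDobrushinMeasure (E (u n)))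
        atTop (𝓝 (∫ c, f c ∂μ))) :
    ∀ᵐ c ∂μ, c.source = D.pt 0 := by
  -- the test function
  set g : CurveClass ℂ →ᵇ ℝ := BoundedContinuousFunction.mkOfBound
    ⟨fun c ↦ min 1 (dist c.source (D.pt 0)),
      (continuous_const.min (RandomPlanarGeometry.CurveClass.continuous_source.dist continuous_const))⟩
    1 (fun c c' ↦ by
      simp only [ContinuousMap.coe_mk, Real.dist_eq]
      have h1 : 0 ≤ min 1 (dist c.source (D.pt 0)) := le_min zero_le_one dist_nonneg
      have h2 : 0 ≤ min 1 (dist c'.source (D.pt 0)) := le_min zero_le_one dist_nonneg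
      have h3 : min 1 (dist c.source (D.pt 0)) ≤ 1 := min_le_left _ _
      have h4 : min 1 (dist c'.source (D.pt 0)) ≤ 1 := min_le_left _ _
      rw [abs_le]; constructor <;> linarith) with hg
  have hg_apply : ∀ c, g c = min 1 (dist c.source (D.pt 0)) := fun c ↦ rfl
  have hg0 : ∀ c, 0 ≤ g c := fun c ↦ by rw [hg_apply]; exact le_min zero_le_one dist_nonneg
  -- `∫ g dμ ≤ ε` for every small `ε > 0`
  have key : ∀ ε : ℝ, 0 < ε → 2 * ε ≤ dist (D.pt 0) (D.pt 1) → ∫ c, g c ∂μ ≤ ε := by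
    intro ε hε hε2
    -- eventually (in the mesh) the lattice conditions hold
    have hev : ∀ᶠ n in atTop, (E (u n)).IsZdAdmissible ∧
        hausdorffEDist (medialPoint (u n) '' (E (u n)).zdABEdges) {D.pt 0, D.pt 1} <
          ENNReal.ofReal ε := by
      have h2 := hE.eventually_isZdAdmissible
      have h3 : ∀ᶠ δ in 𝓝[>] (0 : ℝ),
          hausdorffEDist (medialPoint δ '' (E δ).zdABEdges) {D.pt 0, D.pt 1} < ENNReal.ofReal ε :=
        hE.tendsto_zdABEdges (Iio_mem_nhds (ENNReal.ofReal_pos.2 hε))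
      exact hu.eventually (h2.and h3)
    have hbound : ∀ᶠ n in atTop,
        ∫ ω, g (fkInterfaceCurve D (E (u n)) ω) ∂fkDobrushinMeasure (E (u n)) ≤ ε := by
      filter_upwards [hev] with n hn
      obtain ⟨hadm, hH⟩ := hn
      have hH' : hausdorffEDist (medialPoint (E (u n)).δ '' (E (u n)).zdABEdges) {D.pt 0, D.pt 1} <
          ENNReal.ofReal ε := by
        rw [hE.δ_eq (u n)]
        exact hH
      -- every interface curve at this mesh starts within `ε` of `a`
      have hall : ∀ ω, g (fkInterfaceCurve D (E (u n)) ω) ≤ ε := by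
        intro ω
        rw [hg_apply]
        exact (min_le_right _ _).trans (dist_source_fkInterfaceCurve_lt D hadm ω hε hε2 hH').le
      calc ∫ ω, g (fkInterfaceCurve D (E (u n)) ω) ∂fkDobrushinMeasure (E (u n))
          ≤ ∫ _, ε ∂fkDobrushinMeasure (E (u n)) := by
            refine integral_mono_of_nonneg (ae_of_all _ fun ω ↦ hg0 _) (integrable_const ε)
              (ae_of_all _ fun ω ↦ hall ω)
        _ = ε := by simp
    exact le_of_tendsto (hlim g) hbound
  -- hence `∫ g dμ ≤ 0`, so `g = 0` a.e.
  have hint0 : ∫ c, g c ∂μ = 0 := by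
    refine le_antisymm ?_ (integral_nonneg hg0)
    refine le_of_forall_pos_le_add fun ε hε ↦ ?_
    rw [zero_add]
    have hab : 0 < dist (D.pt 0) (D.pt 1) :=
      dist_pos.2 fun h ↦ absurd (D.pt_injective h) (by decide)
    set ε' : ℝ := min ε (dist (D.pt 0) (D.pt 1) / 2) with hε'
    have hε'0 : 0 < ε' := lt_min hε (by positivity)
    have hε'2 : 2 * ε' ≤ dist (D.pt 0) (D.pt 1) := by
      have := min_le_right ε (dist (D.pt 0) (D.pt 1) / 2)
      linarith
    exact (key ε' hε'0 hε'2).trans (min_le_left _ _)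
  have hgi : Integrable (fun c ↦ g c) μ := g.integrable μ
  have hae := (integral_eq_zero_iff_of_nonneg (fun c ↦ hg0 c) hgi).1 hint0
  filter_upwards [hae] with c hc
  have hc' : min 1 (dist c.source (D.pt 0)) = 0 := hc
  rcases min_eq_iff.1 hc' with ⟨h1, -⟩ | ⟨h2, -⟩
  · exact absurd h1 one_ne_zero
  · exact dist_eq_zero.1 h2

/-- **Subsequential limit laws of the critical FK-Ising interfaces are carried by curves from
`a`.** For admissible discretisations `E` of `(D; a, b)` and every finite measure `μ` which is
a subsequential limit law of the interface curves `fkInterfaceCurve D (E δ)` under the critical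
FK-Ising Dobrushin measures (`IsSubseqLimitLaw`, the preamble of (L)–(M5′)), `μ`-a.e. curve
class starts at `a = D.pt 0` (`ae_source_eq_of_tendsto_fkInterfaceCurve` along the sequence of
meshes witnessing the subsequential limit). This is the clause "`μ`-a.e. `c.source = D.pt 0`"
of the hypotheses (J) of `exists_observableMartingale_fkInterface_of_limitData`
(`FKIsingCylinderIdentityAssembly.lean`).
[cite: CDHKSCRAS2014, §1] -/
theorem ae_source_eq_of_isSubseqLimitLaw_fkInterfaceCurve {D : DobrushinDomain}
    {E : ℝ → DiscreteDobrushin} (hE : IsDiscretisation D E) {μ : Measure (CurveClass ℂ)}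
    [IsFiniteMeasure μ]
    (hlim : IsSubseqLimitLaw (Ωδ := fun _ ↦ BondConfig (Site 2))
      (fun δ ↦ fkInterfaceCurve D (E δ)) (fun δ ↦ fkDobrushinMeasure (E δ)) μ) :
    ∀ᵐ c ∂μ, c.source = D.pt 0 := by
  obtain ⟨u, hu, h⟩ := hlim
  exact ae_source_eq_of_tendsto_fkInterfaceCurve hE hu h

/-! ### The assembly without the clause "curves from `a`" -/

section LimitData

variable {D : DobrushinDomain} {E : ℝ → DiscreteDobrushin}
  {φ : ConformalEquiv upperHalfPlaneSet D.carrier}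
  {μ : Measure (CurveClass ℂ)} [IsProbabilityMeasure μ]
  {Ω' : ℕ → Type*} {mΩ' : ∀ k, MeasurableSpace (Ω' k)} {P : ∀ k, Measure (Ω' k)}
  [∀ k, IsProbabilityMeasure (P k)] {V : ∀ k, ℝ≥0 → Ω' k → ℝ}

/-- **The body of (M5′) for one subsequential limit of the FK interface laws, from (J) without
its source clause and (D).** As `exists_cylinderIdentityData_of_limitData`
(`FKIsingCylinderIdentityAssembly.lean`), for a probability measure `μ` which is a subsequential
limit law of the critical FK-Ising interface curves of admissible discretisations of
`(D; a, b)`: the hypothesis "`μ`-a.e. `c.source = D.pt 0`" of that theorem is discharged by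
`ae_source_eq_of_isSubseqLimitLaw_fkInterfaceCurve`. Remaining inputs: a.e. describability by
the Loewner evolution through `φ` and convergence in distribution of the discrete driving
processes with uniform sub-exponential tails (Kemppainen–Smirnov 2017, Thm. 1.5, Cor. 1.7,
Prop. 3.8 = CDHKS Thm. 3), and the discrete observable martingale data (Duminil-Copin–Smirnov
2012, Lemma 6.6, Thm. 3.15). PROVED.
[cite: CDHKSCRAS2014, Thm. 3 and §3] [cite: DuminilCopinSmirnov2012Clay, Lemma 6.6 and proof of Prop. 6.7 (p. 29)] -/
theorem exists_cylinderIdentityData_of_limitData' (hE : IsDiscretisation D E)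
    (hμ : IsSubseqLimitLaw (Ωδ := fun _ ↦ BondConfig (Site 2))
      (fun δ ↦ fkInterfaceCurve D (E δ)) (fun δ ↦ fkDobrushinMeasure (E δ)) μ)
    (hφ : D.IsChordalUniformizing φ)
    (hdesc : ∀ᵐ c ∂μ, IsLoewnerDescribable φ c)
    (hVc : ∀ k ω, Continuous (V k · ω))
    (hlaw : TendstoInDistribution (fun k ω ↦ (⟨fun u ↦ V k u ω, hVc k ω⟩ : C(ℝ≥0, ℝ))) atTop
      (fun c ↦ (⟨drivingFunction φ c, continuous_drivingFunction φ c⟩ : C(ℝ≥0, ℝ))) P μ)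
    (htail : ∀ t : ℝ≥0, ∃ (K r : ℝ) (n₀ : ℕ), 0 < r ∧ ∀ n : ℕ, n₀ ≤ n →
      ∀ᶠ k in atTop, P k {ω | ∃ u, u ≤ t ∧ (n : ℝ) < |V k u ω|} ≤
        ENNReal.ofReal (K * Real.exp (-r * n)))
    (hD : ∀ y : ℝ, 0 < y → ∀ s t : ℝ≥0, s < t → t < cdhksTime y →
      ∃ (C' : ℝ) (ε Δ η : ℕ → ℝ≥0), Tendsto ε atTop (𝓝 0) ∧ Tendsto Δ atTop (𝓝 0) ∧
        Tendsto η atTop (𝓝 0) ∧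
        ∀ k, ∃ (𝒢 : Filtration ℕ (mΩ' k)) (F : ℕ → Ω' k → ℂ) (σ τ : Ω' k → WithTop ℕ)
          (hσ : IsStoppingTime 𝒢 σ) (M : ℕ) (bad : Set (Ω' k)),
          IsStoppingTime 𝒢 τ ∧ Martingale F 𝒢 (P k) ∧ σ ≤ τ ∧ (∀ ω, τ ω ≤ M) ∧
          (∀ u, u ≤ s → Measurable[hσ.measurableSpace] (V k u)) ∧
          (∀ᵐ ω ∂P k, ‖stoppedValue F σ ω‖ ≤ C') ∧ (∀ᵐ ω ∂P k, ‖stoppedValue F τ ω‖ ≤ C') ∧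
          MeasurableSet bad ∧ P k bad ≤ η k ∧
          ∀ᵐ ω ∂P k, ω ∉ bad →
            (∃ u ∈ Icc s (s + Δ k), ‖stoppedValue F σ ω - observableProcess (V k) y u ω‖ ≤ ε k) ∧
            (∃ u ∈ Icc t (t + Δ k), ‖stoppedValue F τ ω - observableProcess (V k) y u ω‖ ≤ ε k)) :
    ∃ W : CurveClass ℂ → ℝ≥0 → ℝ,
      (∀ t, StronglyMeasurable (fun c ↦ W c t)) ∧ (∀ c, Continuous (W c)) ∧ (∀ c, W c 0 = 0) ∧
      (∀ t : ℝ≥0, ∃ M : CurveClass ℂ → ℝ, MemLp M 3 μ ∧ (∀ c, 0 ≤ M c) ∧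
        ∀ᵐ c ∂μ, ∀ u, u ≤ t → |W c u| ≤ M c) ∧
      (∀ᵐ c ∂μ, Loewner.IsDrivenBy φ.boundaryExtension (D.pt 1) (W c) c) ∧
      ∀ y : ℝ, 0 < y → ∀ s t : ℝ≥0, s ≤ t → ∀ (n : ℕ) (S : Fin n → ℝ≥0), (∀ k, S k ≤ s) →
        ∀ ψ : (Fin n → ℝ) → ℝ, Continuous ψ → (∀ v, |ψ v| ≤ 1) →
          ∫ c, (observableProcess (fun t c ↦ W c t) y t c -
              observableProcess (fun t c ↦ W c t) y s c) * (ψ (fun k ↦ W c (S k)) : ℂ) ∂μ = 0 :=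
  exists_cylinderIdentityData_of_limitData hφ hdesc
    (ae_source_eq_of_isSubseqLimitLaw_fkInterfaceCurve hE hμ) hVc hlaw htail hD

end LimitData

/-- **(L‴) from the limit data (J) ∧ (D), source clause removed.** If for every discretised
Dobrushin domain, every subsequential limit law `μ` of the critical FK-Ising interface laws and
every chordal uniformizing map `φ`: `μ`-a.e. curve class is describable by the Loewner evolution
through `φ`, and there are discrete driving processes converging in distribution to the driving
function of `μ` with uniform sub-exponential tails of their running maxima, together with the
discrete observable martingale data (D) — the hypothesis of
`exists_observableMartingale_fkInterface_of_limitData` (`FKIsingCylinderIdentityAssembly.lean`)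
without its clause "`μ`-a.e. `c.source = D.pt 0`", which holds for every such `μ`
(`ae_source_eq_of_isSubseqLimitLaw_fkInterfaceCurve`) — then the layer-4 named fact (L‴)
`exists_observableMartingale_fkInterface` holds (the stopped FK observable of every subsequential
limit is a martingale for a version of the driving process: DCS 2012, proof of Prop. 6.7, "Since
the convergence is uniform, `M_t(z') := lim M^δ_{τ_t}(z')` is a martingale"; CDHKS 2014, §3):
cylinder-identity data by `exists_cylinderIdentityData_of_limitData'`, natural-filtration
martingales by the monotone-class bridge `martingale_re_im_observableProcess_of_cylinder`, then
optional stopping at the far-field stopping times (`Loewner.martingale_re_stoppedObservable`,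
`Loewner.martingale_im_stoppedObservable`), with the natural filtration of `W` and level
`y₀ = 1`. PROVED.
[cite: CDHKSCRAS2014, Thm. 3 and §3] [cite: DuminilCopinSmirnov2012Clay, Thm. 6.4, Lemma 6.6 and proof of Prop. 6.7 (p. 29)] -/
theorem exists_observableMartingale_fkInterface_of_limitData'
    (h : ∀ (D : DobrushinDomain) (E : ℝ → DiscreteDobrushin), IsDiscretisation D E →
      ∀ (μ : Measure (CurveClass ℂ)) [IsProbabilityMeasure μ],
        IsSubseqLimitLaw (Ωδ := fun _ ↦ BondConfig (Site 2))
          (fun δ ↦ fkInterfaceCurve D (E δ)) (fun δ ↦ fkDobrushinMeasure (E δ)) μ →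
        ∀ φ : ConformalEquiv upperHalfPlaneSet D.carrier, D.IsChordalUniformizing φ →
          (∀ᵐ c ∂μ, IsLoewnerDescribable φ c) ∧
          ∃ (Ω' : ℕ → Type) (mΩ' : ∀ k, MeasurableSpace (Ω' k)) (P : ∀ k, Measure (Ω' k))
            (_ : ∀ k, IsProbabilityMeasure (P k)) (V : ∀ k, ℝ≥0 → Ω' k → ℝ)
            (hVc : ∀ k ω, Continuous (V k · ω)),
            TendstoInDistribution (fun k ω ↦ (⟨fun u ↦ V k u ω, hVc k ω⟩ : C(ℝ≥0, ℝ))) atTop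
              (fun c ↦ (⟨drivingFunction φ c, continuous_drivingFunction φ c⟩ : C(ℝ≥0, ℝ))) P μ ∧
            (∀ t : ℝ≥0, ∃ (K r : ℝ) (n₀ : ℕ), 0 < r ∧ ∀ n : ℕ, n₀ ≤ n →
              ∀ᶠ k in atTop, P k {ω | ∃ u, u ≤ t ∧ (n : ℝ) < |V k u ω|} ≤
                ENNReal.ofReal (K * Real.exp (-r * n))) ∧
            (∀ y : ℝ, 0 < y → ∀ s t : ℝ≥0, s < t → t < cdhksTime y →
              ∃ (C' : ℝ) (ε Δ η : ℕ → ℝ≥0), Tendsto ε atTop (𝓝 0) ∧ Tendsto Δ atTop (𝓝 0) ∧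
                Tendsto η atTop (𝓝 0) ∧
                ∀ k, ∃ (𝒢 : Filtration ℕ (mΩ' k)) (F : ℕ → Ω' k → ℂ) (σ τ : Ω' k → WithTop ℕ)
                  (hσ : IsStoppingTime 𝒢 σ) (M : ℕ) (bad : Set (Ω' k)),
                  IsStoppingTime 𝒢 τ ∧ Martingale F 𝒢 (P k) ∧ σ ≤ τ ∧ (∀ ω, τ ω ≤ M) ∧
                  (∀ u, u ≤ s → Measurable[hσ.measurableSpace] (V k u)) ∧
                  (∀ᵐ ω ∂P k, ‖stoppedValue F σ ω‖ ≤ C') ∧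
                  (∀ᵐ ω ∂P k, ‖stoppedValue F τ ω‖ ≤ C') ∧
                  MeasurableSet bad ∧ P k bad ≤ η k ∧
                  ∀ᵐ ω ∂P k, ω ∉ bad →
                    (∃ u ∈ Icc s (s + Δ k),
                      ‖stoppedValue F σ ω - observableProcess (V k) y u ω‖ ≤ ε k) ∧
                    (∃ u ∈ Icc t (t + Δ k),
                      ‖stoppedValue F τ ω - observableProcess (V k) y u ω‖ ≤ ε k))) :
    exists_observableMartingale_fkInterface := by
  intro D E hE μ hμ hlim φ hφ
  haveI := hμ
  obtain ⟨hdesc, Ω', mΩ', P, hP, V, hVc, hlaw, htail, hD⟩ := h D E hE μ hlim φ hφ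
  obtain ⟨W, hW, hWc, hW0, hmom, hdrv, hcyl⟩ :=
    exists_cylinderIdentityData_of_limitData' hE hlim hφ hdesc hVc hlaw htail hD
  have hWad : StronglyAdapted (Filtration.natural (fun t c ↦ W c t) hW) (fun t c ↦ W c t) :=
    Filtration.stronglyAdapted_natural hW
  refine ⟨W, Filtration.natural (fun t c ↦ W c t) hW, 1, hWad, hWc, hW0, hmom, hdrv,
    fun y hy ↦ ?_⟩
  have hy0 : 0 < y := by linarith
  have hm := martingale_re_im_observableProcess_of_cylinder (W := fun t c ↦ W c t) hW hWc hy0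
    (hcyl y hy0)
  exact ⟨martingale_re_stoppedObservable hWad hWc hy0 hm.1,
    martingale_im_stoppedObservable hWad hWc hy0 hm.2⟩

end Literature.Probability.LatticeModels
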